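import Literature.Computability.Complexity.GateEliminationCase822K

/-!
# Gate elimination: Case 8.2.4.1 of Li–Yang's proof of Theorem 4.1 — the xor-reconstruction step

Li–Yang, ECCC TR21-023, §4.1, Case 8.2.4.1 (p. 32): `G` is an ∧-type gate reading two `1`-gates
`Q` and `P` of the xor-part; after the protected substitution `x_k := d` (Case 6), "we have an
unprotected variable `x_j` on which `Q` depends, so by substituting appropriate constant to `Q`
via xor-reconstruction to trivialize `G`, we have `Δμ ≥ 4 - 4α_φ + α_I` for the substitution
similar to Case 8.1.3. If the potential increment `ΔΦ ≤ 2` for this substitution,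
`Δμ ≥ 4 - 2α_φ + α_I` … Hence in the rest part of this case we assume that `ΔΦ ≥ 3`": the
eliminations are `G` (trivialized, `ΔΦ = 0`: its inputs are a constant and the ⊕-type `P`), the
path slot `B` preceding `Q` (deferred to Case 8.2.5 when it troubles a gate), `P` (now a
`0`-gate, Rule 1) and a reader of `G`.

`case8_2_4_K` performs this step inside the circuit `K` after `x_k := d` (as `case8_2_2_K` does
for Case 8.2.2) and returns either the generic bound `μ' ≤ μ(K, ∅) - α_I - (4 - 2α_φ)` (no
troubled gate is created by the eliminations of `G`, `B`, `P`; the reader of `G` is eliminated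
by Rules 2/3), or the configurations of Case 8.2.5.2 at `B` (as in `case8_2_2_K`), or — when the
deletion of the `0`-gate `P` troubles a gate `T` (the printed items 3(a)–(d) of Case 8.2.4.1 and
Cases 8.2.4.1.1–8.2.4.1.3) — an ∧-type gate of `K` reading the path gate before `Q` and a
variable (again the configuration of Case 8.2.5.2), or an ∧-type gate of `K` reading two
variables one of which is a `3⁺`-variable. The configurations are dispatched in
`GateEliminationCase824.lean`. Everything here is PROVED.

## References

* J. Li, T. Yang, *3.1n − o(n) circuit lower bounds for explicit functions*, STOC 2022
  [LiYang2022]; full version ECCC TR21-023, §2.6, §3.3 (Rule 1, Lemma 3.11),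
  §4.1 (Cases 8.1.3, 8.2.4.1, 8.2.5).
-/

namespace Literature.Computability.Complexity

open Finset

namespace Semicircuit

variable {n : ℕ}

/-- **Deleting a `0`-gate that troubles no gate, from a circuit without troubled gates, lowers
the measure at the empty packing by at least `1`.** [cite: LiYang2022, Lemma 3.11 (Rule 1)] -/
theorem measure_empty_removeGate_le (C : Semicircuit n) (k₀ : Fin C.m) {m' : ℕ}
    (ε : Fin m' ≃ {k : Fin C.m // k ≠ k₀}) (h0 : ∀ k a, C.arg k a ≠ .gate k₀) (R : RdqSource n)
    {αφ αI : ℝ} (αQ : ℝ) (hI : 0 ≤ αI) (hT : ∀ T, ¬ C.Troubled T) (hT' : ∀ T, ¬ (C.removeGate k₀ ε).Troubled T) :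
    (C.removeGate k₀ ε).measure αφ αI αQ ∅ R ≤ C.measure αφ αI αQ ∅ R - 1 := by
  classical
  unfold measure
  rw [potential_empty_of hT, potential_empty_of hT']
  have hm : ((m' : ℕ) : ℝ) + 1 = C.m := by exact_mod_cast C.removeGate_m_add_one k₀ ε
  have hinf : (((C.removeGate k₀ ε).influential R).card : ℝ) ≤ (C.influential R).card := by
    exact_mod_cast card_le_card (C.influential_removeGate_subset k₀ ε h0 R)
  show ((m' : ℕ) : ℝ) + _ + _ + _ ≤ _
  nlinarith [mul_le_mul_of_nonneg_left hinf hI]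

section Main

variable {C : Semicircuit n} {f : (Fin n → ZMod 2) → Bool} {R : RdqSource n} {d : ℕ} {αφ αI αQ : ℝ}

/-- **Case 8.2.4.1 of Li–Yang's proof of Theorem 4.1, the second substitution, inside the
circuit `K` after `x_k := d`** (fair, normalized, no troubled gate, computing `f|_R` with
`dim R ≥ 2d + 2`): `G` is an ∧-type gate reading at `aI` a `1`-gate `I` of the xor-part which
depends on the unprotected `1`-variable `x` (path `p` from `x` to `I`), and at the other wire a
`1`-gate `P₀` of the xor-part. The xor-reconstruction `I := b` trivializing `G` (`Δμ ≥ α_I`) is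
followed by the eliminations of `G` (Rule 2; no troubled gate can appear, the other input being
the ⊕-type `P₀`), of the path slot `B` preceding `I` (Rule 3), of the `0`-gate `P₀` (Rule 1) and
of a reader of `G` (Rules 2/3): `μ' ≤ μ(K, ∅) - α_I - (4 - 2α_φ)` unless the elimination of `B`
or the deletion of `P₀` troubles a gate, in which case one of the following holds in `K`:
(one-gate path) `I` reads besides `x` a `3⁺`-variable; (longer path) an ∧-type gate reads the
path gate preceding `I` and a variable, the other input of `I` being a variable `≠ x`; an ∧-type
gate other than `G` reads two variables, one of out-degree `≥ 3`.
[cite: LiYang2022, §4.1 (Cases 8.2.4.1, 8.2.4.1.1–8.2.4.1.3, 8.2.5), §3.3 (Rule 1), Lemma 3.11] -/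
theorem case8_2_4_K (hf : IsAffineDisperser f d) (hd : 2 * d + 2 ≤ R.dim) (hF : C.Fair)
    (hC : C.ComputesRestr f R) (hN : C.Normalized) (hT : ∀ T, ¬ C.Troubled T)
    (hφ : 0 ≤ αφ) (hI : 0 ≤ αI) (αQ : ℝ)
    {G I P₀ : Fin C.m} {aI : Fin 2} (hand : IsAndOp (C.op G)) (hGI : C.arg G aI = .gate I)
    (hGP : C.arg G aI.rev = .gate P₀) (hP₀K : P₀ ∈ C.xorPart) (hP₀1 : C.fanout (.gate P₀) = 1)
    {x : Fin n} (p : C.XorPath x I) (hdep : C.DependsOn hF I x) (hxp : ¬ R.Protected x)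
    (hx1 : C.fanout (.var x) = 1) (hI1 : C.fanout (.gate I) = 1) :
    (∃ (C' : Semicircuit n) (R' : RdqSource n) (P' : Finset (Fin C'.m × Fin C'.m)),
        C'.Fair ∧ C'.ComputesRestr f R' ∧ C'.IsPacking P' ∧ R'.dim + 1 = R.dim ∧
        C'.measure αφ αI αQ P' R' ≤ C.measure αφ αI αQ ∅ R - αI - (4 - 2 * αφ)) ∨
    (p.len = 0 ∧ ∃ xl : Fin n, p.other (Fin.last p.len) = .var xl ∧ xl ≠ x ∧ 3 ≤ C.fanout (.var xl)) ∨
    (0 < p.len ∧ ∃ (T : Fin C.m) (aT : Fin 2) (t xl : Fin n), T ≠ G ∧ IsAndOp (C.op T) ∧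
        C.arg T aT = .gate (p.gate (p.prev (Fin.last p.len))) ∧ C.arg T aT.rev = .var t ∧
        p.other (Fin.last p.len) = .var xl ∧ xl ≠ x) ∨
    (∃ (T : Fin C.m) (aT : Fin 2) (z t : Fin n), T ≠ G ∧ IsAndOp (C.op T) ∧
        C.arg T aT = .var z ∧ C.arg T aT.rev = .var t ∧ 3 ≤ C.fanout (.var z)) := by
  classical
  have hPN : C.PreNormalized := hN.1
  have hGK : G ∉ C.xorPart := C.not_mem_xorPart_of_isAndOp hand
  have hGoff := p.gate_ne_of_isAndOp hand
  have hGIne : G ≠ I := fun e => hGK (e ▸ p.last_mem_xorPart)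
  have hP₀G : P₀ ≠ G := fun e => hGK (e ▸ hP₀K)
  have hIP₀ : I ≠ P₀ := by
    intro e
    have hne := hPN.arg_zero_ne_arg_one G
    have key : C.arg G aI ≠ C.arg G aI.rev := by
      rcases fin2_eq_or_eq_rev 0 aI with rfl | rfl
      · exact hne
      · exact fun h => hne h.symm
    apply key
    rw [hGI, hGP, e]
  -- `P₀` is off the path (its only reader is `G`)
  have hP₀off : ∀ j, p.gate j ≠ P₀ := by
    intro j e
    rcases Fin.eq_castSucc_or_eq_last j with ⟨j', rfl⟩ | rfl
    · have h := p.arg_succ j'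
      rw [e] at h
      have := eq_of_arg_eq_of_fanout_eq_one hPN.arg_zero_ne_arg_one hP₀1 h hGP
      exact hGoff _ this
    · exact hIP₀ (p.gate_last.symm.trans e)
  -- `I` is read by `G` only
  have hIonly : ∀ {k : Fin C.m} {a : Fin 2}, C.arg k a = .gate I → k = G := fun h =>
    eq_of_arg_eq_of_fanout_eq_one hPN.arg_zero_ne_arg_one hI1 h hGI
  obtain ⟨b, hb⟩ := exists_trivializing hand aI
  obtain ⟨P', hF', hC', hP', hdim, -, -, hμP'⟩ :=
    C.xor_reconstruction hF hC C.isPacking_empty p hdep hxp b hφ hI αQ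
  have hd₂ : 2 * d + 1 ≤ (C.rerouteSource hF b hC p hxp).dim := by omega
  -- no troubled gates after the reconstruction; the measure at the empty packing
  have hT' : ∀ T, ¬ (C.reroute p b).Troubled T := fun T h => hT T (troubled_of_troubled_reroute p b h).1
  have hμ' : (C.reroute p b).measure αφ αI αQ ∅ (C.rerouteSource hF b hC p hxp) ≤
      C.measure αφ αI αQ ∅ R - αI := by
    refine le_trans ?_ hμP'
    unfold measure
    rw [potential_empty_of hT']
    have := (C.reroute p b).potential_nonneg hP'
    nlinarith [mul_le_mul_of_nonneg_left this hφ]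
  -- `G` reads the constant `b` and is trivialized; its other wire is still `P₀`
  have h₀ : (C.reroute p b).arg G aI = .const b := reroute_arg_reader p b hand hGI
  have htriv' : (C.reroute p b).liveFn G aI b false = (C.reroute p b).liveFn G aI b true := by
    rw [liveFn_reroute_reader p b hand]; exact hb
  have hout' : (C.reroute p b).out ≠ .gate G := out_ne_of_trivialized hf (by omega) hF' hC' h₀ htriv'
  have hsyn : (C.reroute p b).SynVal (.gate G) ((C.reroute p b).liveFn G aI b false) :=
    SynVal.of_trivialized _ h₀ htriv'
  have hGw' : (C.reroute p b).arg G aI.rev = .gate P₀ := by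
    rw [reroute_arg_reader_rev p b hand, hGP, Node.reroute_gate_of_ne x I b hIP₀.symm]
  have hP₀K' : P₀ ∈ (C.reroute p b).xorPart := hP₀K
  have hfP₀' : (C.reroute p b).fanout (.gate P₀) = 1 := by
    rw [fanout_reroute_of_generic p b (v := .gate P₀) (by simp) (fun t e => hP₀off t (Node.gate.inj e).symm)
      (by simp)]
    exact hP₀1
  -- Rule 2 on `G`
  let E₁ := elimDataWTriv hF' hC' (C.reroute p b).isPacking_empty h₀ htriv' hout' hφ hI αQ
  have hrepl₁ : E₁.repl = .const ((C.reroute p b).liveFn G aI b false) := rfl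
  -- it creates no troubled gate: the other input of `G` is the ⊕-type gate `P₀`
  have h1 : ∀ T, ¬ E₁.C'.Troubled T := by
    intro T hTT
    obtain ⟨a, ha⟩ := E₁.causedBy_of_new_troubled T hTT (hT' _)
    rcases fin2_eq_or_eq_rev aI a with rfl | rfl
    · rw [h₀] at ha; exact not_causedBy_const ha
    · rw [hGw'] at ha
      rcases ha with hgate | ⟨z, hz, -⟩
      · have hTP : E₁.ι T = P₀ := (Node.gate.inj hgate).symm
        have hTand : IsAndOp ((C.reroute p b).op (E₁.ι T)) := (E₁.isAndOp_iff T).mp hTT.exists_wires.1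
        rw [hTP] at hTand
        exact not_isAndOp_of_isXorOp ((C.reroute p b).isXorOp_of_mem P₀ hP₀K') hTand
      · cases hz
  have hμ₁ : E₁.C'.measure αφ αI αQ ∅ (C.rerouteSource hF b hC p hxp) ≤
      (C.reroute p b).measure αφ αI αQ ∅ (C.rerouteSource hF b hC p hxp) - 1 :=
    E₁.measure_empty_le_of_noTroubled hT' h1 hI
  -- the path slot `B` preceding `I`, reading the constant `b` at wire `0`
  have hB0 : (C.reroute p b).arg (p.gate (p.prev (Fin.last p.len))) 0 = .const b :=
    reroute_arg_prev_last_zero p b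
  have hBK : p.gate (p.prev (Fin.last p.len)) ∈ C.xorPart := p.mem_xorPart _
  have hBG : p.gate (p.prev (Fin.last p.len)) ≠ G := hGoff _
  obtain ⟨B₁, hB₁⟩ := E₁.ι_surj _ hBG
  have hB₁0 : E₁.C'.arg B₁ 0 = .const b :=
    (E₁.arg_eq_const_iff B₁ 0 b).mpr (Or.inl (by rw [hB₁]; exact hB0))
  have hB₁K : B₁ ∈ E₁.C'.xorPart := (E₁.mem_xorPart_iff B₁).mpr (by rw [hB₁]; exact hBK)
  have hB1' : (C.reroute p b).arg (p.gate (p.prev (Fin.last p.len))) 1 =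
      (p.other (Fin.last p.len)).reroute x I b := by
    rw [reroute_arg_gate_one, p.next_prev]
  have hBnotG : (C.reroute p b).arg (p.gate (p.prev (Fin.last p.len))) 1 ≠ .gate G := fun h =>
    hGK ((C.reroute p b).mem_of_arg_eq _ hBK 1 G h)
  have hB₁1 : (E₁.C'.arg B₁ 1).embed E₁.ι = (p.other (Fin.last p.len)).reroute x I b := by
    rw [E₁.arg_eq, hB₁, if_neg hBnotG, hB1']
  -- Rule 3 on `B₁`
  have hdegB := liveFn_xor_of_isXorOp (E₁.C'.isXorOp_of_mem B₁ hB₁K) (0 : Fin 2) b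
  have houtB : E₁.C'.out ≠ .gate B₁ := out_ne_gate_of_mem_xorPart hf hd₂ E₁.fair E₁.computes hB₁K
  let E₂ := elimDataWBypass E₁.fair E₁.computes E₁.C'.isPacking_empty _ hB₁0 hdegB houtB hφ hI αQ
  have hrepl₂ : E₂.repl = E₁.C'.arg B₁ 1 := rfl
  -- an ∧-type gate two eliminations down, and its variable wires, read back in `C`
  have hback : ∀ (T₂ : Fin E₂.C'.m), IsAndOp (E₂.C'.op T₂) →
      IsAndOp (C.op (E₁.ι (E₂.ι T₂))) ∧ (∀ j, p.gate j ≠ E₁.ι (E₂.ι T₂)) ∧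
      ∀ (a' : Fin 2) (v : Fin n), E₂.C'.arg T₂ a' = .var v →
        (C.arg (E₁.ι (E₂.ι T₂)) a' = .var v ∧ v ≠ x) ∨
        (C.arg (E₁.ι (E₂.ι T₂)) a' = .gate (p.gate (p.prev (Fin.last p.len))) ∧ 0 < p.len ∧
          E₁.C'.arg B₁ 1 = .var v ∧ p.other (Fin.last p.len) = .var v ∧ v ≠ x) := by
    intro T₂ hT₂and
    have hT₁and : IsAndOp (E₁.C'.op (E₂.ι T₂)) := (E₂.isAndOp_iff T₂).mp hT₂and
    have hT'and' : IsAndOp ((C.reroute p b).op (E₁.ι (E₂.ι T₂))) := (E₁.isAndOp_iff _).mp hT₁and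
    have hT'off := not_mem_of_isAndOp p b hT'and'
    have hT'and : IsAndOp (C.op (E₁.ι (E₂.ι T₂))) := by
      rwa [reroute_op_of_not_mem p b hT'off] at hT'and'
    refine ⟨hT'and, hT'off, fun a' v hv => ?_⟩
    rcases (E₂.arg_eq_var_iff T₂ a' v).mp hv with hdirect | ⟨hvia, hD⟩
    · left
      rcases (E₁.arg_eq_var_iff (E₂.ι T₂) a' v).mp hdirect with h | ⟨-, h⟩
      · rw [reroute_arg_of_not_mem p b hT'off] at h
        exact (Node.reroute_eq_var_iff x I b).mp h
      · rw [hrepl₁] at h; cases h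
    · right
      rw [hrepl₂] at hD
      have hother : p.other (Fin.last p.len) = .var v ∧ v ≠ x := by
        have h := hB₁1
        rw [hD] at h
        exact (Node.reroute_eq_var_iff x I b).mp h.symm
      have hT'B' : (C.reroute p b).arg (E₁.ι (E₂.ι T₂)) a' = .gate (p.gate (p.prev (Fin.last p.len))) := by
        rcases (E₁.arg_eq_gate_iff (E₂.ι T₂) a' B₁).mp hvia with h | ⟨-, h⟩
        · rw [hB₁] at h; exact h
        · rw [hrepl₁] at h; cases h
      rw [reroute_arg_of_not_mem p b hT'off] at hT'B'
      have hpos : 0 < p.len := by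
        by_contra hlen
        push Not at hlen
        have hlen0 : p.len = 0 := by omega
        have hBI : p.gate (p.prev (Fin.last p.len)) = I := by
          rw [p.eq_last_of_len_eq_zero hlen0 (p.prev (Fin.last p.len)), p.gate_last]
        rw [hBI] at hT'B'
        have hTx : C.arg (E₁.ι (E₂.ι T₂)) a' = .var x := (Node.reroute_eq_gate_self_iff x I b).mp hT'B'
        have := eq_of_arg_eq_of_fanout_eq_one hPN.arg_zero_ne_arg_one hx1 hTx p.arg_zero
        exact hT'off 0 this.symm
      have hBI : p.gate (p.prev (Fin.last p.len)) ≠ I := p.gate_prev_last_ne hpos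
      exact ⟨(Node.reroute_eq_gate_iff_of_ne x I b hBI).mp hT'B', hpos, hD, hother.1, hother.2⟩
  ------------------------------------------------------------------------------------------
  -- the elimination of `B₁` creates a troubled gate: Case 8.2.5.2 (as in `case8_2_2_K`)
  by_cases h2 : ∃ T, E₂.C'.Troubled T
  · obtain ⟨T, hTT⟩ := h2
    obtain ⟨a, ha⟩ := E₂.causedBy_of_new_troubled T hTT (h1 _)
    have ha1 : a = 1 := by
      rcases fin2_eq_or_eq_rev (0 : Fin 2) a with rfl | rfl
      · rw [hB₁0] at ha; exact absurd ha not_causedBy_const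
      · rfl
    rw [ha1] at ha
    have hT₁and : IsAndOp (E₁.C'.op (E₂.ι T)) := (E₂.isAndOp_iff T).mp hTT.exists_wires.1
    rcases ha with hgate | ⟨xl, hxl, aT₀, haT₀⟩
    · -- `B₁` read an ∧-type gate: excluded, the xor-part is closed
      exfalso
      have hmem : E₂.ι T ∈ E₁.C'.xorPart := E₁.C'.mem_of_arg_eq B₁ hB₁K 1 _ hgate
      exact not_isAndOp_of_isXorOp (E₁.C'.isXorOp_of_mem _ hmem) hT₁and
    · -- `B₁` read the variable `x_l`, which troubles `T`
      have hother : p.other (Fin.last p.len) = .var xl ∧ xl ≠ x := by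
        have h := hB₁1
        rw [hxl] at h
        exact (Node.reroute_eq_var_iff x I b).mp h.symm
      obtain ⟨aT, t, htl, haTl, haTt, hfl, hft⟩ := hTT.exists_wires_of_reads ⟨aT₀, haT₀⟩
      have hTf : E₂.C'.fanout (.gate T) = 1 := hTT.exists_wires.2.1
      have hT₁B : E₂.ι T ≠ B₁ := E₂.ι_ne T
      -- the second wire of `E₂.ι T` is the variable `t`, in `E₁.C'`, `C.reroute p b` and `C`
      have hT₁t : E₁.C'.arg (E₂.ι T) aT.rev = .var t := by
        rcases (E₂.arg_eq_var_iff T aT.rev t).mp haTt with h | ⟨-, h⟩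
        · exact h
        · exfalso
          rw [hrepl₂, hxl] at h
          exact htl (Node.var.inj h).symm
      have hT'and' : IsAndOp ((C.reroute p b).op (E₁.ι (E₂.ι T))) := (E₁.isAndOp_iff _).mp hT₁and
      have hT'off := not_mem_of_isAndOp p b hT'and'
      have hT'and : IsAndOp (C.op (E₁.ι (E₂.ι T))) := by
        rwa [reroute_op_of_not_mem p b hT'off] at hT'and'
      have hT't' : (C.reroute p b).arg (E₁.ι (E₂.ι T)) aT.rev = .var t := by
        rcases (E₁.arg_eq_var_iff (E₂.ι T) aT.rev t).mp hT₁t with h | ⟨-, h⟩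
        · exact h
        · rw [hrepl₁] at h; cases h
      have hT't : C.arg (E₁.ι (E₂.ι T)) aT.rev = .var t := by
        rw [reroute_arg_of_not_mem p b hT'off] at hT't'
        exact ((Node.reroute_eq_var_iff x I b).mp hT't').1
      -- the first wire of `E₂.ι T`: `x_l` itself, or `B₁`
      rcases (E₂.arg_eq_var_iff T aT xl).mp haTl with hdirect | ⟨hvia, -⟩
      · ---- `T` read `x_l` directly: `B₁` is a `0`-gate and `x_l` a `3`-variable (8.2.5.2.1.1)
        have hsum : E₁.C'.fanout (.var xl) + E₁.C'.fanout (.gate B₁) = 3 := by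
          have h := E₂.fanout_repl_add
          rw [hrepl₂, hxl] at h
          have hpull : E₂.pull (.var xl) = .var xl := rfl
          have hone : (univ.filter fun a : Fin 2 => E₁.C'.arg B₁ a = .var xl).card = 1 := by
            rw [card_eq_one]
            refine ⟨1, ?_⟩
            ext a'
            rw [mem_filter, mem_singleton]
            constructor
            · rintro ⟨-, h'⟩
              rcases fin2_eq_or_eq_rev (0 : Fin 2) a' with rfl | rfl
              · rw [hB₁0] at h'; cases h'
              · rfl
            · rintro rfl; exact ⟨mem_univ _, hxl⟩
          rw [hpull, hone, hfl] at h
          omega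
        have h2le : 2 ≤ E₁.C'.fanout (.var xl) := two_le_fanout_of_ne hT₁B hdirect hxl
        -- `x_l` is not a `2`-variable of `E₁.C'`, else `E₂.ι T` was troubled there
        have hne2 : E₁.C'.fanout (.var xl) ≠ 2 := by
          intro h2'
          refine h1 (E₂.ι T) ⟨hT₁and, ?_, xl, t, htl.symm, range_arg_eq_pair hdirect hT₁t, h2', ?_⟩
          · have h := E₂.fanout_gate_add (k' := T) (by rw [hrepl₂, hxl]; exact fun h => by cases h)
            have h0 : (univ.filter fun a : Fin 2 => E₁.C'.arg B₁ a = .gate (E₂.ι T)).card = 0 := by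
              rw [card_eq_zero, filter_eq_empty_iff]
              intro a' _ h'
              rcases fin2_eq_or_eq_rev (0 : Fin 2) a' with rfl | rfl
              · rw [hB₁0] at h'; cases h'
              · exact absurd (hxl.symm.trans h') (by simp)
            rw [h0, hTf] at h
            omega
          · have h := E₂.fanout_var_add (i := t) (by rw [hrepl₂, hxl]; exact fun h => htl (Node.var.inj h).symm)
            have h0 : (univ.filter fun a : Fin 2 => E₁.C'.arg B₁ a = .var t).card = 0 := by
              rw [card_eq_zero, filter_eq_empty_iff]
              intro a' _ h'
              rcases fin2_eq_or_eq_rev (0 : Fin 2) a' with rfl | rfl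
              · rw [hB₁0] at h'; cases h'
              · exact htl (Node.var.inj (hxl.symm.trans h')).symm
            rw [h0, hft] at h
            omega
        have hfl3 : E₁.C'.fanout (.var xl) = 3 := by omega
        have hfB : E₁.C'.fanout (.gate B₁) = 0 := by omega
        -- hence the path has one gate: otherwise the path slot before `B` reads `B`
        have hlen : p.len = 0 := by
          by_contra hlen
          have hpos : 0 < p.len := Nat.pos_of_ne_zero hlen
          have hBI : p.gate (p.prev (Fin.last p.len)) ≠ I := p.gate_prev_last_ne hpos
          have hRB : (C.reroute p b).arg (p.gate (p.prev (p.prev (Fin.last p.len)))) 0 =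
              .gate (p.gate (p.prev (Fin.last p.len))) := by
            rw [reroute_arg_gate_zero, p.next_prev, Node.reroute_gate_of_ne x I b hBI]
          obtain ⟨j', hj'⟩ := E₁.ι_surj (p.gate (p.prev (p.prev (Fin.last p.len)))) (hGoff _)
          have hj'B : E₁.C'.arg j' 0 = .gate B₁ :=
            (E₁.arg_eq_gate_iff j' 0 B₁).mpr (Or.inl (by rw [hj', hB₁]; exact hRB))
          have := fanout_pos_of_arg_eq hj'B
          omega
        -- and `x_l` is a `3⁺`-variable of `C`
        have hflC : 3 ≤ C.fanout (.var xl) := by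
          have h := E₁.fanout_var_add (i := xl) (by rw [hrepl₁]; exact fun h => by cases h)
          rw [← fanout_reroute_of_generic p b (v := .var xl) (fun e => hother.2 (Node.var.inj e))
            (by simp) (by simp)]
          omega
        exact Or.inr (Or.inl ⟨hlen, xl, hother.1, hother.2, hflC⟩)
      · ---- `T` read `B₁`: an ∧-type gate of `C` reads the path gate before `I` (8.2.5.2.1.2–5, 8.2.5.2.2)
        have hT'B' : (C.reroute p b).arg (E₁.ι (E₂.ι T)) aT = .gate (p.gate (p.prev (Fin.last p.len))) := by
          rcases (E₁.arg_eq_gate_iff (E₂.ι T) aT B₁).mp hvia with h | ⟨-, h⟩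
          · rw [hB₁] at h; exact h
          · rw [hrepl₁] at h; cases h
        rw [reroute_arg_of_not_mem p b hT'off] at hT'B'
        -- the path has at least two gates: otherwise `T` would read `x`
        have hpos : 0 < p.len := by
          by_contra hlen
          push Not at hlen
          have hlen0 : p.len = 0 := by omega
          have hBI : p.gate (p.prev (Fin.last p.len)) = I := by
            rw [p.eq_last_of_len_eq_zero hlen0 (p.prev (Fin.last p.len)), p.gate_last]
          rw [hBI] at hT'B'
          have hTx : C.arg (E₁.ι (E₂.ι T)) aT = .var x := (Node.reroute_eq_gate_self_iff x I b).mp hT'B'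
          have := eq_of_arg_eq_of_fanout_eq_one hPN.arg_zero_ne_arg_one hx1 hTx p.arg_zero
          exact hT'off 0 this.symm
        have hBI : p.gate (p.prev (Fin.last p.len)) ≠ I := p.gate_prev_last_ne hpos
        have hT'B : C.arg (E₁.ι (E₂.ι T)) aT = .gate (p.gate (p.prev (Fin.last p.len))) :=
          (Node.reroute_eq_gate_iff_of_ne x I b hBI).mp hT'B'
        refine Or.inr (Or.inr (Or.inl ⟨hpos, E₁.ι (E₂.ι T), aT, t, xl, E₁.ι_ne _, hT'and, hT'B, hT't,
          hother.1, hother.2⟩))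
  ------------------------------------------------------------------------------------------
  push Not at h2
  have hμ₂ : E₂.C'.measure αφ αI αQ ∅ (C.rerouteSource hF b hC p hxp) ≤
      E₁.C'.measure αφ αI αQ ∅ (C.rerouteSource hF b hC p hxp) - 1 :=
    E₂.measure_empty_le_of_noTroubled h1 h2 hI
  ------------------------------------------------------------------------------------------
  -- `P₀` two eliminations down: a `0`-gate of the xor-part
  obtain ⟨P₁, hP₁⟩ := E₁.ι_surj P₀ hP₀G
  have hP₁K : P₁ ∈ E₁.C'.xorPart := (E₁.mem_xorPart_iff P₁).mpr (by rw [hP₁]; exact hP₀K')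
  have hfP₁ : E₁.C'.fanout (.gate P₁) = 0 := by
    have h := E₁.fanout_gate_add (k' := P₁) (by rw [hrepl₁]; exact fun h => by cases h)
    rw [hP₁, hfP₀'] at h
    have h1 : (univ.filter fun a : Fin 2 => (C.reroute p b).arg G a = .gate P₀).card = 1 := by
      rw [card_eq_one]
      refine ⟨aI.rev, ?_⟩
      ext a'
      rw [mem_filter, mem_singleton]
      constructor
      · rintro ⟨-, h'⟩
        rcases fin2_eq_or_eq_rev aI a' with rfl | rfl
        · rw [h₀] at h'; cases h'
        · rfl
      · rintro rfl; exact ⟨mem_univ _, hGw'⟩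
    omega
  have hP₁B : P₁ ≠ B₁ := by
    intro e
    apply hP₀off (p.prev (Fin.last p.len))
    rw [← hB₁, ← e, hP₁]
  obtain ⟨P₂, hP₂⟩ := E₂.ι_surj P₁ hP₁B
  have hP₂K : P₂ ∈ E₂.C'.xorPart := (E₂.mem_xorPart_iff P₂).mpr (by rw [hP₂]; exact hP₁K)
  -- the other wire of `B₁` is not `P₁` (else `I` read `P₀`)
  have hDP : E₁.C'.arg B₁ 1 ≠ .gate P₁ := by
    intro h
    have h' := hB₁1
    rw [h] at h'
    change Node.gate (E₁.ι P₁) = _ at h'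
    rw [hP₁] at h'
    have hIP : p.other (Fin.last p.len) = .gate P₀ := (Node.reroute_eq_gate_iff_of_ne x I b hIP₀.symm).mp h'.symm
    unfold XorPath.other at hIP
    rw [p.gate_last] at hIP
    exact hGIne (eq_of_arg_eq_of_fanout_eq_one hPN.arg_zero_ne_arg_one hP₀1 hIP hGP).symm
  have hfP₂ : E₂.C'.fanout (.gate P₂) = 0 := by
    have h := E₂.fanout_gate_add (k' := P₂) (by rw [hrepl₂, hP₂]; exact hDP)
    rw [hP₂, hfP₁] at h
    omega
  have h0₃ : ∀ k a, E₂.C'.arg k a ≠ .gate P₂ := (fanout_eq_zero_iff _ _).mp hfP₂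
  have houtP : E₂.C'.out ≠ .gate P₂ := out_ne_gate_of_mem_xorPart hf hd₂ E₂.fair E₂.computes hP₂K
  -- Rule 1 on `P₂`
  set ε := E₂.C'.skipEquiv P₂ with hε
  have hF₃ : (E₂.C'.removeGate P₂ ε).Fair := E₂.fair.removeGate ε h0₃
  have hC₃ : (E₂.C'.removeGate P₂ ε).ComputesRestr f (C.rerouteSource hF b hC p hxp) :=
    E₂.computes.removeGate ε E₂.fair h0₃ houtP
  ------------------------------------------------------------------------------------------
  -- the deletion of `P₂` creates a troubled gate
  by_cases h3 : ∃ T, (E₂.C'.removeGate P₂ ε).Troubled T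
  · obtain ⟨T, hTT⟩ := h3
    obtain ⟨a, ha⟩ := E₂.C'.causedBy_of_new_troubled_removeGate P₂ ε h0₃ hTT (h2 _)
    have hT₂and : IsAndOp (E₂.C'.op (ε T)) := hTT.exists_wires.1
    -- the cause is a variable wire `z` of `P₂`
    obtain ⟨z, hPz, aT₀, haT₀⟩ : ∃ z, E₂.C'.arg P₂ a = .var z ∧ ∃ aT, (E₂.C'.removeGate P₂ ε).arg T aT = .var z := by
      cases hka : E₂.C'.arg P₂ a with
      | const c => rw [hka] at ha; exact absurd ha not_causedBy_const
      | var z =>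
        rw [hka] at ha
        rcases ha with h | ⟨z', hz', aT, haT⟩
        · cases h
        · cases hz'; exact ⟨z, rfl, aT, haT⟩
      | gate g =>
        exfalso
        rw [hka] at ha
        rcases ha with h | ⟨z', hz', -⟩
        · have hg : (ε T : Fin E₂.C'.m) = g := (Node.gate.inj h).symm
          have hmem : g ∈ E₂.C'.xorPart := E₂.C'.mem_of_arg_eq P₂ hP₂K a g hka
          rw [← hg] at hmem
          exact not_isAndOp_of_isXorOp (E₂.C'.isXorOp_of_mem _ hmem) hT₂and
        · cases hz'
    obtain ⟨aT, t, htz, haTz, haTt, hfz3, hft3⟩ := hTT.exists_wires_of_reads ⟨aT₀, haT₀⟩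
    have hTf3 : (E₂.C'.removeGate P₂ ε).fanout (.gate T) = 1 := hTT.exists_wires.2.1
    -- the wires of `ε T` in `E₂.C'`
    have hT₂z : E₂.C'.arg (ε T) aT = .var z := (Node.skip_eq_var_iff P₂ ε).mp haTz
    have hT₂t : E₂.C'.arg (ε T) aT.rev = .var t := (Node.skip_eq_var_iff P₂ ε).mp haTt
    obtain ⟨hT'and, hT'off, hargs⟩ := hback (ε T) hT₂and
    -- if one of them came through `B₁`: the configuration of Case 8.2.5.2 on a longer path
    rcases hargs aT z hT₂z with ⟨hTzC, hzx⟩ | ⟨hT'B, hpos, -, hoth, hox⟩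
    swap
    · rcases hargs aT.rev t hT₂t with ⟨hTtC, -⟩ | ⟨-, -, hD, -, -⟩
      · exact Or.inr (Or.inr (Or.inl ⟨hpos, _, aT, t, z, E₁.ι_ne _, hT'and, hT'B, hTtC, hoth, hox⟩))
      · -- both wires of `ε T` cannot come through `B₁` (`z ≠ t`)
        exfalso
        rcases (E₂.arg_eq_var_iff (ε T) aT z).mp hT₂z with h | ⟨-, h⟩
        · -- direct in `E₁.C'` but via `B₁` in `C`? then the `C`-wire is a variable
          rcases (E₁.arg_eq_var_iff (E₂.ι (ε T)) aT z).mp h with h' | ⟨-, h'⟩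
          · rw [reroute_arg_of_not_mem p b hT'off, hT'B] at h'
            exact absurd h' (by
              intro h''
              have := (Node.reroute_eq_var_iff x I b).mp h''
              cases this.1)
          · rw [hrepl₁] at h'; cases h'
        · rw [hrepl₂, hD] at h
          exact htz (Node.var.inj h)
    rcases hargs aT.rev t hT₂t with ⟨hTtC, htx⟩ | ⟨hT'B, hpos, -, hoth, hox⟩
    swap
    · refine Or.inr (Or.inr (Or.inl ⟨hpos, _, aT.rev, z, t, E₁.ι_ne _, hT'and, hT'B, ?_, hoth, hox⟩))
      rw [Fin.rev_rev]; exact hTzC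
    -- both wires are variables of `C` directly: one of them is a `3⁺`-variable
    suffices h3z : 3 ≤ C.fanout (.var z) ∨ 3 ≤ C.fanout (.var t) by
      rcases h3z with h3z | h3t
      · exact Or.inr (Or.inr (Or.inr ⟨_, aT, z, t, E₁.ι_ne _, hT'and, hTzC, hTtC, h3z⟩))
      · refine Or.inr (Or.inr (Or.inr ⟨_, aT.rev, t, z, E₁.ι_ne _, hT'and, hTtC, ?_, h3t⟩))
        rw [Fin.rev_rev]; exact hTzC
    by_contra hle
    push Not at hle
    obtain ⟨hz2, ht2⟩ := hle
    -- out-degree bookkeeping along the three eliminations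
    -- the gate itself: a `1`-gate throughout
    have hTf2 : E₂.C'.fanout (.gate (ε T : Fin E₂.C'.m)) = 1 := by
      have h := E₂.C'.fanout_removeGate_gate_add P₂ ε h0₃ T
      have h0 : (univ.filter fun a' : Fin 2 => E₂.C'.arg P₂ a' = .gate (ε T : Fin E₂.C'.m)).card = 0 := by
        rw [card_eq_zero, filter_eq_empty_iff]
        intro a' _ h'
        have hmem := E₂.C'.mem_of_arg_eq P₂ hP₂K a' _ h'
        exact not_isAndOp_of_isXorOp (E₂.C'.isXorOp_of_mem _ hmem) hT₂and
      rw [h0, hTf3] at h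
      omega
    have hT₁and : IsAndOp (E₁.C'.op (E₂.ι (ε T))) := (E₂.isAndOp_iff _).mp hT₂and
    have hTf1 : E₁.C'.fanout (.gate (E₂.ι (ε T))) = 1 := by
      have h := E₂.fanout_gate_add (k' := (ε T : Fin E₂.C'.m)) (by
        rw [hrepl₂]
        intro h'
        have hmem := E₁.C'.mem_of_arg_eq B₁ hB₁K 1 _ h'
        exact not_isAndOp_of_isXorOp (E₁.C'.isXorOp_of_mem _ hmem) hT₁and)
      have h0 : (univ.filter fun a' : Fin 2 => E₁.C'.arg B₁ a' = .gate (E₂.ι (ε T))).card = 0 := by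
        rw [card_eq_zero, filter_eq_empty_iff]
        intro a' _ h'
        have hmem := E₁.C'.mem_of_arg_eq B₁ hB₁K a' _ h'
        exact not_isAndOp_of_isXorOp (E₁.C'.isXorOp_of_mem _ hmem) hT₁and
      rw [h0, hTf2] at h
      omega
    have hTf' : (C.reroute p b).fanout (.gate (E₁.ι (E₂.ι (ε T)))) = 1 := by
      have h := E₁.fanout_gate_add (k' := E₂.ι (ε T)) (by rw [hrepl₁]; exact fun h => by cases h)
      have h0 : (univ.filter fun a' : Fin 2 => (C.reroute p b).arg G a' = .gate (E₁.ι (E₂.ι (ε T)))).card = 0 := by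
        rw [card_eq_zero, filter_eq_empty_iff]
        intro a' _ h'
        rcases fin2_eq_or_eq_rev aI a' with rfl | rfl
        · rw [h₀] at h'; cases h'
        · rw [hGw'] at h'
          have hTP : E₁.ι (E₂.ι (ε T)) = P₀ := (Node.gate.inj h').symm
          have hT'and' : IsAndOp ((C.reroute p b).op (E₁.ι (E₂.ι (ε T)))) := (E₁.isAndOp_iff _).mp hT₁and
          rw [hTP] at hT'and'
          exact not_isAndOp_of_isXorOp ((C.reroute p b).isXorOp_of_mem P₀ hP₀K') hT'and'
      rw [h0, hTf1] at h
      omega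
    have hTfC : C.fanout (.gate (E₁.ι (E₂.ι (ε T)))) = 1 := by
      rw [← fanout_reroute_of_generic p b (v := .gate (E₁.ι (E₂.ι (ε T)))) (by simp)
        (fun t' e => hT'off t' (Node.gate.inj e).symm) (by simp)]
      exact hTf'
    -- the variables: unchanged from `C` to `E₁.C'`
    have hvar1 : ∀ {v : Fin n}, v ≠ x → E₁.C'.fanout (.var v) = C.fanout (.var v) := by
      intro v hvx
      have h := E₁.fanout_var_add (i := v) (by rw [hrepl₁]; exact fun h => by cases h)
      have h0 : (univ.filter fun a' : Fin 2 => (C.reroute p b).arg G a' = .var v).card = 0 := by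
        rw [card_eq_zero, filter_eq_empty_iff]
        intro a' _ h'
        rcases fin2_eq_or_eq_rev aI a' with rfl | rfl
        · rw [h₀] at h'; cases h'
        · rw [hGw'] at h'; cases h'
      rw [h0, add_zero, fanout_reroute_of_generic p b (v := .var v) (fun e => hvx (Node.var.inj e)) (by simp)
        (by simp)] at h
      exact h
    -- from `E₂.C'` to the circuit after deleting `P₂`: `z` loses at least one wire
    have hz2' : 3 ≤ E₂.C'.fanout (.var z) := by
      have h := E₂.C'.fanout_removeGate_var_add P₂ ε h0₃ z
      have h1 : 1 ≤ (univ.filter fun a' : Fin 2 => E₂.C'.arg P₂ a' = .var z).card :=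
        card_pos.mpr ⟨a, mem_filter.mpr ⟨mem_univ _, hPz⟩⟩
      rw [hfz3] at h
      omega
    have ht2' : 2 ≤ E₂.C'.fanout (.var t) := by
      have h := E₂.C'.fanout_removeGate_var_add P₂ ε h0₃ t
      rw [hft3] at h
      omega
    -- from `E₁.C'` to `E₂.C'`: through the bypass of `B₁`, whose other wire is `D₁`
    by_cases hDz : E₁.C'.arg B₁ 1 = .var z
    · -- `D₁ = z`: then `I` reads `z` in `C`, `D₁ ≠ t`, `fanout_C(t) = 2`, and `ε T` was troubled in `C`
      have hDt : E₁.C'.arg B₁ 1 ≠ .var t := by rw [hDz]; exact fun h => htz (Node.var.inj h).symm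
      have ht1 : E₁.C'.fanout (.var t) = E₂.C'.fanout (.var t) := by
        have h := E₂.fanout_var_add (i := t) (by rw [hrepl₂]; exact hDt)
        have h0 : (univ.filter fun a' : Fin 2 => E₁.C'.arg B₁ a' = .var t).card = 0 := by
          rw [card_eq_zero, filter_eq_empty_iff]
          intro a' _ h'
          rcases fin2_eq_or_eq_rev (0 : Fin 2) a' with rfl | rfl
          · rw [hB₁0] at h'; cases h'
          · exact hDt h'
        rw [h0] at h
        omega
      have htC : C.fanout (.var t) = 2 := by
        have := hvar1 htx; omega
      -- `I` reads `z`
      have hother : p.other (Fin.last p.len) = .var z ∧ z ≠ x := by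
        have h := hB₁1
        rw [hDz] at h
        exact (Node.reroute_eq_var_iff x I b).mp h.symm
      have hIz : C.arg I (p.pos (Fin.last p.len)).rev = .var z := by
        have h := hother.1
        unfold XorPath.other at h
        rw [p.gate_last] at h
        exact h
      have hIT : I ≠ E₁.ι (E₂.ι (ε T)) := fun e => hT'off (Fin.last p.len) (p.gate_last.trans e)
      have hzC2 : 2 ≤ C.fanout (.var z) := two_le_fanout_of_ne hIT hIz hTzC
      have hzC : C.fanout (.var z) = 2 := by omega
      exact hT _ ⟨hT'and, hTfC, z, t, htz.symm, range_arg_eq_pair hTzC hTtC, hzC, htC⟩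
    · -- `D₁ ≠ z`: `z` keeps its out-degree `≥ 3` back to `C`
      have hz1 : E₁.C'.fanout (.var z) = E₂.C'.fanout (.var z) := by
        have h := E₂.fanout_var_add (i := z) (by rw [hrepl₂]; exact hDz)
        have h0 : (univ.filter fun a' : Fin 2 => E₁.C'.arg B₁ a' = .var z).card = 0 := by
          rw [card_eq_zero, filter_eq_empty_iff]
          intro a' _ h'
          rcases fin2_eq_or_eq_rev (0 : Fin 2) a' with rfl | rfl
          · rw [hB₁0] at h'; cases h'
          · exact hDz h'
        rw [h0] at h
        omega
      have := hvar1 hzx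
      omega
  ------------------------------------------------------------------------------------------
  push Not at h3
  have hμ₃ : (E₂.C'.removeGate P₂ ε).measure αφ αI αQ ∅ (C.rerouteSource hF b hC p hxp) ≤
      E₂.C'.measure αφ αI αQ ∅ (C.rerouteSource hF b hC p hxp) - 1 :=
    E₂.C'.measure_empty_removeGate_le P₂ ε h0₃ _ αQ hI h2 h3
  -- a reader `H` of `G`, doomed, three eliminations down
  have houtC : C.out ≠ .gate G := by
    intro h
    apply hout'
    rw [reroute_out, h, Node.reroute_gate_of_ne x I b hGIne]
  obtain ⟨H, aH, hHG⟩ : ∃ (H : Fin C.m) (aH : Fin 2), C.arg H aH = .gate G := by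
    by_contra hno
    push Not at hno
    exact houtC (hPN.out_of_fanout_eq_zero G ((fanout_eq_zero_iff C _).mpr hno))
  have hHK : H ∉ C.xorPart := fun hHK => hGK (C.mem_of_arg_eq H hHK aH G hHG)
  have hHoff : ∀ j, p.gate j ≠ H := fun j e => hHK (e ▸ p.mem_xorPart j)
  have hHG' : (C.reroute p b).arg H aH = .gate G := by
    rw [reroute_arg_of_not_mem p b hHoff, hHG, Node.reroute_gate_of_ne x I b hGIne]
  have hHdoom : H ∈ (C.reroute p b).doomed := mem_doomed_of_reads _ hHG' hsyn
  have hHG : H ≠ G := fun e => C.arg_ne_self_of_not_mem hGK aH (e ▸ hHG)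
  obtain ⟨H₁, hH₁⟩ := E₁.ι_surj H hHG
  have hH₁d : H₁ ∈ E₁.C'.doomed := E₁.doomed_of H₁ (by rw [hH₁]; exact hHdoom)
  have hH₁B : H₁ ≠ B₁ := fun e => hHK (by rw [← hH₁, e, hB₁]; exact hBK)
  obtain ⟨H₂, hH₂⟩ := E₂.ι_surj H₁ hH₁B
  have hH₂d : H₂ ∈ E₂.C'.doomed := E₂.doomed_of H₂ (by rw [hH₂]; exact hH₁d)
  have hH₂P : H₂ ≠ P₂ := by
    intro e
    have : H₁ ∈ E₁.C'.xorPart := by rw [← hH₂, e, hP₂]; exact hP₁K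
    exact hHK (by rw [← hH₁]; exact (E₁.mem_xorPart_iff H₁).mp this)
  have hH₃d : ε.symm ⟨H₂, hH₂P⟩ ∈ (E₂.C'.removeGate P₂ ε).doomed :=
    E₂.C'.mem_doomed_removeGate P₂ ε h0₃ (k := ε.symm ⟨H₂, hH₂P⟩) (by simp; exact hH₂d)
  have h1card : 1 ≤ (E₂.C'.removeGate P₂ ε).doomed.card := card_pos.mpr ⟨_, hH₃d⟩
  obtain ⟨D', P'', hFD, hCD, hPD, -, hμD⟩ :=
    cascade_doomed' hf hd₂ hφ hI αQ 1 (E₂.C'.removeGate P₂ ε) ∅ hF₃ hC₃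
      (E₂.C'.removeGate P₂ ε).isPacking_empty h1card
  refine Or.inl ⟨D', C.rerouteSource hF b hC p hxp, P'', hFD, hCD, hPD, hdim, ?_⟩
  push_cast at hμD
  linarith

end Main

end Semicircuit

end Literature.Computability.Complexity
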